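import Summits.ResolutionOfSingularities.ResolutionOfSingularities.Theorems.HilbertSamuelEliminationSigmaMaxModificationsCorridor3SigmaIsoReaches
import Summits.ResolutionOfSingularities.ResolutionOfSingularities.Theorems.HilbertSamuelEliminationSigmaMaxModificationsCorridor3SigmaStrataLineages
import Summits.ResolutionOfSingularities.ResolutionOfSingularities.Theorems.HilbertSamuelEliminationSigmaMaxModificationsCorridor3WLadderStrataDepthBlowup
import Summits.ResolutionOfSingularities.ResolutionOfSingularities.Theorems.HilbertSamuelEliminationSigmaMaxModificationsCorridor3WLadderDepthAcrossStep
import HarnessLib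

/-!
# [OURS · L1 W4.2] σ-LAYER — `Corridor3SigmaStrataDepth`: the PER-STEP DEPTH LAWS for an ARBITRARY admissible strategy
# (`StepProjectionσ`; boundary-reading `StepProjectionσE` in the sibling `…SigmaStrataDepthE`), σ-port of res-type-053's depth kit
# (p527422 · p528109 · p529564)

Crux chain w42 (`SigmaMaxModifications`, stmt-ResolutionOfSingularities-18506; conjunct `SigmaMaxModificationsCorridor3`,
stmt-ResolutionOfSingularities-19249); cell E3 «births control beyond the toric scope» of ELIMINATION LINE v2 (res-L1-w42-plan-1); typer
res-type-053 (gen 11; standing reader for res-type-067's `SigmaBirthDictionary3`, RULINGS v3.14-16 (EO) / v3.14-17 (FA)). OURS (cell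
res-hironaka, slot W4.2); NOT statements of H. Hironaka's manuscript [Hironaka2017] nor of [CossartJannsenSaito2020]; AI-proved, weaker than
expert review. Sorry-free PROOF file: no definition, no named fact, no binder, no characteristic hypothesis; `--supports
stmt-ResolutionOfSingularities-19249 --as helper` (counted 0).

WHAT. The three depth laws of `…Corridor3WLadderStrataDepthBlowup` (abstract permissible blow-up step) read at ONE σ-STEP PROJECTION
`f : X_{n+1} ⟶ X_n` of res-type-012's `StepProjectionσ σ 3 ν s s' f` (boundary-blind `Sigma.Strategy`), for a strategy ADMISSIBLE ON THE
MARKED SCOPE (047's `IsAdmissibleStrategyOn (Strategy.ReachableState p σ 3 ν)`) at a stage σ-reached from a maximal origin — the template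
of 012's `StepProjectionσ.image_hsStratum_subset` (kit: `IsMaximalOrigin.of_reachesσ` for `x_n` closed and `dim X_n ≤ 3`, `step_spec` for
permissibility of the allowed centre). The centre clauses are stated in the
«for every step σ allows from the state of `s`» shape of res-type-040's `IsMovingBirthAt.exists_host` (no functionality needed; for a
functional σ use `Strategy.IsFunctional.forall_step` to feed one known allowed centre):

* §1 `IsBlowup.injOn_compl_preimage_support` (a blow-up is injective off the preimage of its centre — general-`f` form of res-type-067's
  lemma), `StepProjectionσ.exists_step_and_isBlowup`, `StepProjectionσ.isClosed_pt`.
* §2 ANY σ: `StepProjectionσ.exists_centre_or_coheight_le` / `…exists_centre_of_hasSandwichAt` — either over the centre or no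
  deeper (a depth jump lies OVER THE CENTRE; conjunct (b) of res-type-040's `StrataDepthDiscipline` per σ-step);
  `StepProjectionσ.exists_fibre_generization_of_hasSandwichAt` — a depth jump through the chain point is carried by the fibre;
  `StepProjectionσ.preimage_pt_subset_of_not_mem` / `…hasSandwichAt_closure_image_of_not_mem` — **a step whose centre MISSES `x_n`
  carries NO depth jump** (one-point fibre; res-D-brk-3's `Helpers.exists_sandwich_image_of_fibre_subset`).
* §3 ADMISSIBLE σ from a maximal origin: `…hasSandwichAt_closure_image_of_surface_centre` — **every allowed centre through `x_n` of
  codimension `≥ 2` at `x_n` ⇒ NO depth jump**; `…eq_of_specializes_of_base_eq_of_surface_centre` (no two points over `x_n` specialise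
  to one another); `…exists_fibre_component_subset_of_hasSandwichAt` — **every allowed centre through `x_n` positive-dimensional at `x_n`:
  a depth jump puts a whole irreducible component `cl z'` of `f⁻¹(x_n)` through `x_{n+1}` inside `Z'`**; `…preimage_pt_subset_of_
  hasSandwichAt_of_curve_centre` (irreducible fibre ⇒ `f⁻¹(x_n) ⊆ Z'`, «the whole fibre over `x_n` is near»).
* (sibling `…Corridor3SigmaStrataDepthE.lean`, same seat) the same three laws over `StepProjectionσE` for a boundary-READING `StrategyE`
  — the form a MENU-DISCIPLINED strategy (res-L1-type-o1 `…SigmaMenuStrategy`, res-type-067 `…SigmaMenu*`) calls at its steps.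
-/

noncomputable section

set_option linter.dupNamespace false

open CategoryTheory AlgebraicGeometry TopologicalSpace Topology Order IsLocalRing
open Literature.AlgebraicGeometry.Resolution Literature.RingTheory.HilbertSamuel
open Summit.ResolutionOfSingularities.ResolutionOfSingularities.Theorems.CampaignW42
open Summit.ResolutionOfSingularities.ResolutionOfSingularities.Theorems.SigmaMaxModificationsCorridor3.Moving
open Scheme.IdealSheafData

namespace Summit.ResolutionOfSingularities.ResolutionOfSingularities.Theorems.SigmaMaxModificationsCorridor3.Sigma

universe u

variable {p : ℕ} {N : ℕ} {ν : ℕ → ℕ}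

/-! ## §1. Blow-ups are injective off the centre; σ-step projections are blow-ups in an allowed centre -/

/-- **A blow-up is injective off the preimage of its centre** (it is an isomorphism over the complement of the centre, Stacks 02OS =
tree `IsBlowup.isIso_compl`); general-`f` form of res-type-067's `Sigma.injOn_compl_preimage_support`. [cite: StacksProject, Tag 02OS] -/
theorem IsBlowup.injOn_compl_preimage_support {W W' : Scheme.{u}} {f : W' ⟶ W} {C : W.IdealSheafData} (hbl : IsBlowup f C) :
    Set.InjOn f.base (f.base ⁻¹' (C.support : Set W))ᶜ := by
  set U : W.Opens := ⟨(C.support : Set W)ᶜ, C.support.isClosed.isOpen_compl⟩ with hU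
  haveI : IsIso (f ∣_ U) := hbl.isIso_compl
  intro a ha b hb hab
  have ha' : a ∈ f ⁻¹ᵁ U := ha
  have hb' : b ∈ f ⁻¹ᵁ U := hb
  have heq : (f ∣_ U).base ⟨a, ha'⟩ = (f ∣_ U).base ⟨b, hb'⟩ := by
    apply Subtype.ext
    rw [morphismRestrict_base_coe, morphismRestrict_base_coe]
    exact hab
  exact congrArg Subtype.val ((f ∣_ U).isOpenEmbedding.injective heq)

/-- **Off the centre the fibres of a blow-up are single points**: if `f x' = y ∉ V(C)` then `f⁻¹(y) ⊆ {x'}`. [cite: StacksProject, Tag 02OS] -/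
theorem IsBlowup.preimage_singleton_subset_of_not_mem {W W' : Scheme.{u}} {f : W' ⟶ W} {C : W.IdealSheafData} (hbl : IsBlowup f C)
    {x' : W'} (hnot : f.base x' ∉ (C.support : Set W)) : f.base ⁻¹' {f.base x'} ⊆ {x'} := by
  intro w hw
  have hw' : f.base w = f.base x' := hw
  refine IsBlowup.injOn_compl_preimage_support hbl ?_ ?_ hw'
  · show w ∉ f.base ⁻¹' (C.support : Set W)
    rw [Set.mem_preimage, hw']; exact hnot
  · exact hnot

section Blind

variable {σ : Strategy.{u}}

/-- **A σ-step projection IS a blow-up of `X_n` in a centre σ allows from the state of `s`** (σ-copy of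
`StepProjection.exists_isCanonicalStep_and_isBlowup`, p519941). [folklore] -/
theorem StepProjectionσ.exists_step_and_isBlowup {s s' : MarkedStage.{u}} {f : s'.W ⟶ s.W} (hf : StepProjectionσ σ N ν s s' f) :
    ∃ (C : s.W.IdealSheafData) (P' : Option (Pending (blowup C))), σ.step s.W s.ln N ν s.L s.P C P' ∧ IsBlowup f C := by
  obtain ⟨C, P', h, x', hcs, -, -, -, e, hfe⟩ := hf
  refine ⟨C, P', hcs, ?_⟩
  rw [hfe]
  exact (blowup.isBlowup C).iso_comp (eqToIso (congrArg MarkedStage.W e))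

/-- The marked point of the target of a σ-step projection is closed. [folklore] -/
theorem StepProjectionσ.isClosed_pt {s s' : MarkedStage.{u}} {f : s'.W ⟶ s.W} (hf : StepProjectionσ σ N ν s s' f) :
    IsClosed ({s'.pt} : Set s'.W) :=
  hf.canonicalNearStepσ.isClosed_pt

/-- **For a FUNCTIONAL σ a property of ONE allowed centre is a property of EVERY allowed centre** (the centre is unique) — the adapter
from a known step `(C, P')` to the «∀ allowed step» clauses below. [folklore] -/
theorem Strategy.IsFunctional.forall_step (hσ : σ.IsFunctional N ν) {s : MarkedStage.{u}} {C : s.W.IdealSheafData}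
    {P' : Option (Pending (blowup C))} (hcs : σ.step s.W s.ln N ν s.L s.P C P') {Q : s.W.IdealSheafData → Prop} (hQ : Q C) :
    ∀ (C' : s.W.IdealSheafData) (P'' : Option (Pending (blowup C'))), σ.step s.W s.ln N ν s.L s.P C' P'' → Q C' := by
  intro C' P'' h'
  obtain rfl : C = C' := (hσ s.W s.ln s.L s.P).1 C C' P' P'' hcs h'
  exact hQ

/-! ## §2. Any σ: a depth jump is carried by the fibre; a step whose centre misses `x_n` carries no depth jump -/

/-- **A DEPTH JUMP THROUGH THE CHAIN POINT IS CARRIED BY THE FIBRE** (σ-copy of `StepProjection.exists_fibre_generization_of_hasSandwichAt`,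
p527422): along a σ-step projection with `x_n` closed, an irreducible closed `Z' ∋ x_{n+1}` with a sandwich at `x_{n+1}` and none at `x_n`
in `cl f(Z')` contains a generisation `z' ≠ x_{n+1}` of `x_{n+1}` inside `f⁻¹(x_n)`. Any σ, any level. [cite: Matsumura1987, Thm. 15.1] -/
theorem StepProjectionσ.exists_fibre_generization_of_hasSandwichAt {s s' : MarkedStage.{u}} {f : s'.W ⟶ s.W}
    (hf : StepProjectionσ σ N ν s s' f) (hsc : IsClosed ({s.pt} : Set s.W)) {Z' : Set s'.W} (hirr : IsIrreducible Z')
    (hcl : IsClosed Z') (hx' : s'.pt ∈ Z') (hup : HasSandwichAt s' Z') (hdown : ¬ HasSandwichAt s (closure (f.base '' Z'))) :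
    ∃ z' ∈ Z', z' ⤳ s'.pt ∧ z' ≠ s'.pt ∧ f.base z' = s.pt := by
  haveI := s.ln
  haveI := s'.ln
  have hpt : f.base s'.pt = s.pt := hf.base_pt
  have hyc : IsClosed ({f.base s'.pt} : Set s.W) := by rw [hpt]; exact hsc
  have hdown' : ¬ ∃ B : Set s.W, IsIrreducible B ∧ IsClosed B ∧ f.base s'.pt ∈ B ∧ B ⊆ closure (f.base '' Z') ∧
      B ≠ {f.base s'.pt} ∧ B ≠ closure (f.base '' Z') := by rw [hpt]; exact hdown
  obtain ⟨z', hz', hzx, hne, hfz⟩ := exists_fibre_generization_of_sandwich f hf.isClosed_pt hyc hirr hcl hx' hup hdown'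
  exact ⟨z', hz', hzx, hne, hfz.trans hpt⟩

/-- Core of the one-point-fibre law, over the bare data «`f` a blow-up in a centre missing `x_n`». [folklore] -/
theorem hasSandwichAt_closure_image_of_isBlowup_of_not_mem {s s' : MarkedStage.{u}} {f : s'.W ⟶ s.W} {C : s.W.IdealSheafData}
    (hbl : IsBlowup f C) (hpt : f.base s'.pt = s.pt) (hcl' : IsClosed ({s'.pt} : Set s'.W)) (hnot : s.pt ∉ (C.support : Set s.W))
    {Z' : Set s'.W} (hirr : IsIrreducible Z') (hcl : IsClosed Z') (hup : HasSandwichAt s' Z') :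
    HasSandwichAt s (closure (f.base '' Z')) := by
  haveI := s.ln
  haveI := s'.ln
  obtain ⟨B', hB'irr, hB'cl, hxB', hB'Z', hB'x, hB'ne⟩ := hup
  have hnot' : f.base s'.pt ∉ (C.support : Set s.W) := by rw [hpt]; exact hnot
  have hfib : Z' ∩ f.base ⁻¹' {f.base s'.pt} ⊆ {s'.pt} :=
    fun w hw => IsBlowup.preimage_singleton_subset_of_not_mem hbl hnot' hw.2
  obtain ⟨B, hBirr, hBcl, hxB, hBZ, hBx, hBne⟩ :=
    Helpers.exists_sandwich_image_of_fibre_subset f hcl' hirr hcl hB'irr hB'cl hxB' hB'Z' hB'x hB'ne hfib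
  rw [hpt] at hxB hBx
  exact ⟨B, hBirr, hBcl, hxB, hBZ, hBx, hBne⟩

/-- **Over `x_n` OFF every allowed centre the fibre is the marked point**: if no step σ allows from the state of `s` has its centre through
`x_n`, then `f⁻¹(x_n) ⊆ {x_{n+1}}`. [cite: StacksProject, Tag 02OS] -/
theorem StepProjectionσ.preimage_pt_subset_of_not_mem {s s' : MarkedStage.{u}} {f : s'.W ⟶ s.W} (hf : StepProjectionσ σ N ν s s' f)
    (hC : ∀ (C : s.W.IdealSheafData) (P' : Option (Pending (blowup C))), σ.step s.W s.ln N ν s.L s.P C P' →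
      s.pt ∉ (C.support : Set s.W)) :
    f.base ⁻¹' {s.pt} ⊆ {s'.pt} := by
  obtain ⟨C, P', hcs, hbl⟩ := hf.exists_step_and_isBlowup
  have hnot : f.base s'.pt ∉ (C.support : Set s.W) := by rw [hf.base_pt]; exact hC C P' hcs
  rw [← hf.base_pt]
  exact IsBlowup.preimage_singleton_subset_of_not_mem hbl hnot

/-- **A σ-STEP WHOSE CENTRE MISSES `x_n` CARRIES NO DEPTH JUMP**: if no step σ allows from the state of `s` has its centre through `x_n`
(a WAITING step for the marked point), then for every irreducible closed `Z'` a sandwich at `x_{n+1}` in `Z'` gives a sandwich at `x_n` in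
`cl f(Z')` (depth does not jump across a one-point fibre, res-D-brk-3 p519213). Any σ, any level. [cite: Matsumura1987, Thm. 15.1] -/
theorem StepProjectionσ.hasSandwichAt_closure_image_of_not_mem {s s' : MarkedStage.{u}} {f : s'.W ⟶ s.W}
    (hf : StepProjectionσ σ N ν s s' f)
    (hC : ∀ (C : s.W.IdealSheafData) (P' : Option (Pending (blowup C))), σ.step s.W s.ln N ν s.L s.P C P' →
      s.pt ∉ (C.support : Set s.W))
    {Z' : Set s'.W} (hirr : IsIrreducible Z') (hcl : IsClosed Z') (hup : HasSandwichAt s' Z') :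
    HasSandwichAt s (closure (f.base '' Z')) := by
  obtain ⟨C, P', hcs, hbl⟩ := hf.exists_step_and_isBlowup
  exact hasSandwichAt_closure_image_of_isBlowup_of_not_mem hbl hf.base_pt hf.isClosed_pt (hC C P' hcs) hirr hcl hup

/-- **EITHER OVER THE CENTRE, OR NO DEEPER** (σ-copy of `StepProjection.exists_centre_or_coheight_le`, p519941): along a σ-step projection,
for every irreducible closed `Z' ∋ x_{n+1}`: either `cl f(Z')` lies in the support of the step's centre (a centre σ allows from the state of `s`),
or `codim_{Z'}(x_{n+1}) ≤ codim_{cl f(Z')}(x_n)` (LIB `IsBlowup.coheight_le_coheight_closure_image`). Any σ, any level. [cite: Matsumura1987, Thm. 15.5] -/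
theorem StepProjectionσ.exists_centre_or_coheight_le {s s' : MarkedStage.{u}} {f : s'.W ⟶ s.W} (hf : StepProjectionσ σ N ν s s' f)
    {Z' : Set s'.W} (hirr : IsIrreducible Z') (hcl : IsClosed Z') (hx' : s'.pt ∈ Z') :
    (∃ (C : s.W.IdealSheafData) (P' : Option (Pending (blowup C))), σ.step s.W s.ln N ν s.L s.P C P' ∧ IsBlowup f C ∧
        closure (f.base '' Z') ⊆ (C.support : Set s.W)) ∨
      coheight (⟨s'.pt, hx'⟩ : ↥Z') ≤ coheight (⟨s.pt, subset_closure ⟨s'.pt, hx', hf.base_pt⟩⟩ : ↥(closure (f.base '' Z'))) := by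
  haveI := s.ln
  haveI := s'.ln
  obtain ⟨C, P', hcs, hbl⟩ := hf.exists_step_and_isBlowup
  by_cases hB : closure (f.base '' Z') ⊆ (C.support : Set s.W)
  · exact Or.inl ⟨C, P', hcs, hbl, hB⟩
  · refine Or.inr ?_
    have key := hbl.coheight_le_coheight_closure_image hirr hcl hx' hB
    have e : (⟨f.base s'.pt, subset_closure ⟨s'.pt, hx', rfl⟩⟩ : ↥(closure (f.base '' Z'))) =
        ⟨s.pt, subset_closure ⟨s'.pt, hx', hf.base_pt⟩⟩ := Subtype.ext hf.base_pt
    rw [e] at key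
    exact key

/-- **A DEPTH JUMP LIES OVER THE CENTRE** (σ-copy of `StepProjection.exists_centre_of_sandwich`, conjunct (b) of res-type-040's
`StrataDepthDiscipline` at one σ-step): along a σ-step projection with `x_n` closed, an irreducible closed `Z' ∋ x_{n+1}` with a sandwich at
`x_{n+1}` and none at `x_n` in `cl f(Z')` has `cl f(Z')` INSIDE the support of the step's centre. Any σ, any level. [cite: Matsumura1987, Thm. 15.5] -/
theorem StepProjectionσ.exists_centre_of_hasSandwichAt {s s' : MarkedStage.{u}} {f : s'.W ⟶ s.W} (hf : StepProjectionσ σ N ν s s' f)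
    (hsc : IsClosed ({s.pt} : Set s.W)) {Z' : Set s'.W} (hirr : IsIrreducible Z') (hcl : IsClosed Z') (hx' : s'.pt ∈ Z')
    (hup : HasSandwichAt s' Z') (hdown : ¬ HasSandwichAt s (closure (f.base '' Z'))) :
    ∃ (C : s.W.IdealSheafData) (P' : Option (Pending (blowup C))), σ.step s.W s.ln N ν s.L s.P C P' ∧ IsBlowup f C ∧
      closure (f.base '' Z') ⊆ (C.support : Set s.W) := by
  haveI := s.ln
  haveI := s'.ln
  rcases hf.exists_centre_or_coheight_le hirr hcl hx' with h | hle
  · exact h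
  · exfalso
    have hirrB : IsIrreducible (closure (f.base '' Z')) := (hirr.image f.base f.continuous.continuousOn).closure
    have h2 : 2 ≤ coheight (⟨s'.pt, hx'⟩ : ↥Z') := (two_le_coheight_iff_exists_sandwich hirr hcl hx' hf.isClosed_pt).mpr hup
    exact hdown ((two_le_coheight_iff_exists_sandwich hirrB isClosed_closure
      (subset_closure ⟨s'.pt, hx', hf.base_pt⟩) hsc).mp (h2.trans hle))

/-! ## §3. Admissible σ from a maximal origin (level `3`): surface centres carry no depth jump; positive-dimensional centres swallow a
fibre component -/

/-- **EVERY ALLOWED CENTRE THROUGH `x_n` A SURFACE THERE ⇒ NO DEPTH JUMP.** σ admissible on the marked scope, `s` σ-reached from a maximal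
origin of characteristic `p` (level `3`, value `ν`), `f` a σ-step projection; if every centre σ allows from the state of `s` that passes
through `x_n` has codimension `≥ 2` at `x_n` inside its support, then for every irreducible closed `Z' ∋ x_{n+1}` a sandwich at `x_{n+1}`
forces a sandwich at `x_n` in `cl f(Z')` (steps whose centre misses `x_n` included, §2). σ-copy of
`hasSandwichAt_closure_image_of_surface_centre` (p527422) with the cycle invariant replaced by the maximal-origin kit.
[cite: CossartJannsenSaito2020, Thm. 3.10 (proof, p. 46)] [cite: Matsumura1987, Thm. 15.1] -/
theorem StepProjectionσ.hasSandwichAt_closure_image_of_surface_centre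
    (hadm : IsAdmissibleStrategyOn (Strategy.ReachableState p σ 3 ν) 3 ν σ)
    {X : Scheme.{u}} [IsLocallyNoetherian X] {x : X} (hX : IsMaximalOrigin p 3 ν X x) {s s' : MarkedStage.{u}}
    (hreach : Reachesσ σ 3 ν (MarkedStage.init X x) s) {f : s'.W ⟶ s.W} (hf : StepProjectionσ σ 3 ν s s' f)
    (hC : ∀ (C : s.W.IdealSheafData) (P' : Option (Pending (blowup C))), σ.step s.W s.ln 3 ν s.L s.P C P' →
      ∀ hx : s.pt ∈ (C.support : Set s.W), 2 ≤ coheight (⟨s.pt, hx⟩ : ↥(C.support : Set s.W)))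
    {Z' : Set s'.W} (hirr : IsIrreducible Z') (hcl : IsClosed Z') (hx' : s'.pt ∈ Z') (hup : HasSandwichAt s' Z') :
    HasSandwichAt s (closure (f.base '' Z')) := by
  haveI := s.ln
  haveI := s'.ln
  obtain ⟨C, P', hcs, hbl⟩ := hf.exists_step_and_isBlowup
  have hpt : f.base s'.pt = s.pt := hf.base_pt
  by_cases hxC : s.pt ∈ (C.support : Set s.W)
  · have hO : IsMaximalOrigin p 3 ν s.W s.pt := hX.of_reachesσ hadm hreach
    have hperm : IdealSheafData.IsPermissible C := (hadm.step_spec (inScopeMσ_of_reachesσ hX hreach) hcs).1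
    have hyC : f.base s'.pt ∈ (C.support : Set s.W) := by rw [hpt]; exact hxC
    have hsurf : 2 ≤ coheight (⟨f.base s'.pt, hyC⟩ : ↥(C.support : Set s.W)) := by
      have e : (⟨f.base s'.pt, hyC⟩ : ↥(C.support : Set s.W)) = ⟨s.pt, hxC⟩ := Subtype.ext hpt
      rw [e]; exact hC C P' hcs hxC
    have hyc : IsClosed ({f.base s'.pt} : Set s.W) := by rw [hpt]; exact hO.isClosed
    obtain ⟨B, hBirr, hBcl, hxB, hBZ, hBx, hBne⟩ := IsBlowup.sandwich_image_of_two_le_coheight_support hbl hO.dim_le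
      hf.isClosed_pt hyc ((IdealSheafData.isPermissible_iff C).mp hperm _ hyC) hyC hsurf hirr hcl hx' hup
    rw [hpt] at hxB hBx
    exact ⟨B, hBirr, hBcl, hxB, hBZ, hBx, hBne⟩
  · exact hasSandwichAt_closure_image_of_isBlowup_of_not_mem hbl hpt hf.isClosed_pt hxC hirr hcl hup

/-- **By-product: every allowed centre through `x_n` a surface there ⇒ no two points over `x_n` specialise to one another** (the fibre of
the permissible blow-up over `x_n` is finite; off the centre it is one point). σ-copy of
`StepProjection.eq_of_specializes_of_base_eq_of_surface_centre` (p527422). [cite: CossartJannsenSaito2020, Thm. 3.10 (proof, p. 46)] -/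
theorem StepProjectionσ.eq_of_specializes_of_base_eq_of_surface_centre
    (hadm : IsAdmissibleStrategyOn (Strategy.ReachableState p σ 3 ν) 3 ν σ)
    {X : Scheme.{u}} [IsLocallyNoetherian X] {x : X} (hX : IsMaximalOrigin p 3 ν X x) {s s' : MarkedStage.{u}}
    (hreach : Reachesσ σ 3 ν (MarkedStage.init X x) s) {f : s'.W ⟶ s.W} (hf : StepProjectionσ σ 3 ν s s' f)
    (hC : ∀ (C : s.W.IdealSheafData) (P' : Option (Pending (blowup C))), σ.step s.W s.ln 3 ν s.L s.P C P' →
      ∀ hx : s.pt ∈ (C.support : Set s.W), 2 ≤ coheight (⟨s.pt, hx⟩ : ↥(C.support : Set s.W)))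
    {z' w' : s'.W} (hzw : z' ⤳ w') (hz : f.base z' = s.pt) (hw : f.base w' = s.pt) : z' = w' := by
  haveI := s.ln
  haveI := s'.ln
  obtain ⟨C, P', hcs, hbl⟩ := hf.exists_step_and_isBlowup
  by_cases hxC : s.pt ∈ (C.support : Set s.W)
  · have hO : IsMaximalOrigin p 3 ν s.W s.pt := hX.of_reachesσ hadm hreach
    have hperm : IdealSheafData.IsPermissible C := (hadm.step_spec (inScopeMσ_of_reachesσ hX hreach) hcs).1
    have hwC : f.base w' ∈ (C.support : Set s.W) := by rw [hw]; exact hxC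
    have hpermw : IdealSheafData.IsPermissibleAt C (f.base w') := (IdealSheafData.isPermissible_iff C).mp hperm _ hwC
    haveI hregC : IsRegularLocalRing (s.W.presheaf.stalk (f.base w') ⧸ stalkIdeal C (f.base w')) := hpermw.1
    obtain ⟨d, hd⟩ : ∃ d : ℕ, ringKrullDim (s.W.presheaf.stalk (f.base w') ⧸ stalkIdeal C (f.base w')) = d :=
      exists_nat_eq_of_ne_bot_of_ne_top ringKrullDim_ne_bot ringKrullDim_ne_top
    have h2d : 2 ≤ d := by
      have h1 : ((coheight (⟨f.base w', hwC⟩ : ↥(C.support : Set s.W)) : ℕ∞) : WithBot ℕ∞) ≤ (((d : ℕ) : ℕ∞) : WithBot ℕ∞) := by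
        have h1 := coheight_le_ringKrullDim_quotient_stalkIdeal C hwC
        rw [hd] at h1
        rwa [← WithBot.coe_natCast] at h1
      have e : (⟨s.pt, hxC⟩ : ↥(C.support : Set s.W)) = ⟨f.base w', hwC⟩ := Subtype.ext hw.symm
      have h3 : ((2 : ℕ) : ℕ∞) ≤ (d : ℕ∞) := by
        have h4 : (2 : ℕ∞) ≤ (d : ℕ∞) := (e ▸ hC C P' hcs hxC).trans (WithBot.coe_le_coe.mp h1)
        exact_mod_cast h4
      exact_mod_cast h3
    have hdimX : ringKrullDim (s.W.presheaf.stalk (f.base w')) ≤ ((d + 1 : ℕ) : WithBot ℕ∞) := by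
      have hyX : coheight (f.base w') ≤ (3 : ℕ) := (topologicalKrullDim_le_iff_forall_coheight_le s.W 3).mp hO.dim_le _
      rw [AlgebraicGeometry.ringKrullDim_stalk_eq_coheight]
      have h1 : ((coheight (f.base w') : ℕ∞) : WithBot ℕ∞) ≤ (((3 : ℕ) : ℕ∞) : WithBot ℕ∞) := WithBot.coe_le_coe.mpr hyX
      rw [WithBot.coe_natCast] at h1
      exact h1.trans (by exact_mod_cast (by omega : 3 ≤ d + 1))
    exact hbl.eq_of_specializes_of_base_eq hzw (hz.trans hw.symm) hpermw hd hdimX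
  · -- off the centre the fibre over `x_n` is the single point `x_{n+1}`
    have hsub := IsBlowup.preimage_singleton_subset_of_not_mem hbl (show f.base s'.pt ∉ (C.support : Set s.W) by
      rw [hf.base_pt]; exact hxC)
    have hz' : z' ∈ f.base ⁻¹' {f.base s'.pt} := by show f.base z' ∈ ({f.base s'.pt} : Set s.W); rw [hf.base_pt, hz]; rfl
    have hw' : w' ∈ f.base ⁻¹' {f.base s'.pt} := by show f.base w' ∈ ({f.base s'.pt} : Set s.W); rw [hf.base_pt, hw]; rfl
    exact (Set.mem_singleton_iff.mp (hsub hz')).trans (Set.mem_singleton_iff.mp (hsub hw')).symm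

/-- **EVERY ALLOWED CENTRE THROUGH `x_n` POSITIVE-DIMENSIONAL THERE: A DEPTH JUMP SWALLOWS A FIBRE COMPONENT.** σ admissible on the
marked scope, `s` σ-reached from a maximal origin (level `3`), `f` a σ-step projection; if every centre σ allows from the state of `s`
that passes through `x_n` has codimension `≥ 1` at `x_n` inside its support, then for every irreducible closed `Z' ∋ x_{n+1}` with a sandwich
at `x_{n+1}` and none at `x_n` in `cl f(Z')` there is `z'` over `x_n`, `z' ⤳ x_{n+1}`, `z' ≠ x_{n+1}`, MAXIMAL in the fibre `f⁻¹(x_n)`, with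
`cl z' ⊆ Z'` — the fibre component `cl z'` through `x_{n+1}` lies in `Z'`. (A step whose centre misses `x_n` carries no depth jump, so the
hypothesis on `Z'` is then absurd.) σ-copy of `exists_fibre_component_subset_of_hasSandwichAt` (p528109).
[cite: CossartJannsenSaito2020, Thm. 3.10 (proof, p. 46)] [cite: Matsumura1987, Thm. 15.1] -/
theorem StepProjectionσ.exists_fibre_component_subset_of_hasSandwichAt
    (hadm : IsAdmissibleStrategyOn (Strategy.ReachableState p σ 3 ν) 3 ν σ)
    {X : Scheme.{u}} [IsLocallyNoetherian X] {x : X} (hX : IsMaximalOrigin p 3 ν X x) {s s' : MarkedStage.{u}}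
    (hreach : Reachesσ σ 3 ν (MarkedStage.init X x) s) {f : s'.W ⟶ s.W} (hf : StepProjectionσ σ 3 ν s s' f)
    (hC : ∀ (C : s.W.IdealSheafData) (P' : Option (Pending (blowup C))), σ.step s.W s.ln 3 ν s.L s.P C P' →
      ∀ hx : s.pt ∈ (C.support : Set s.W), 1 ≤ coheight (⟨s.pt, hx⟩ : ↥(C.support : Set s.W)))
    {Z' : Set s'.W} (hirr : IsIrreducible Z') (hcl : IsClosed Z') (hx' : s'.pt ∈ Z') (hup : HasSandwichAt s' Z')
    (hdown : ¬ HasSandwichAt s (closure (f.base '' Z'))) :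
    ∃ z' : s'.W, f.base z' = s.pt ∧ z' ⤳ s'.pt ∧ z' ≠ s'.pt ∧ (∀ w : s'.W, f.base w = s.pt → w ⤳ z' → w = z') ∧
      closure ({z'} : Set s'.W) ⊆ Z' := by
  haveI := s.ln
  haveI := s'.ln
  obtain ⟨C, P', hcs, hbl⟩ := hf.exists_step_and_isBlowup
  have hpt : f.base s'.pt = s.pt := hf.base_pt
  by_cases hxC : s.pt ∈ (C.support : Set s.W)
  · have hO : IsMaximalOrigin p 3 ν s.W s.pt := hX.of_reachesσ hadm hreach
    have hperm : IdealSheafData.IsPermissible C := (hadm.step_spec (inScopeMσ_of_reachesσ hX hreach) hcs).1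
    have hyC : f.base s'.pt ∈ (C.support : Set s.W) := by rw [hpt]; exact hxC
    have hpos : 1 ≤ coheight (⟨f.base s'.pt, hyC⟩ : ↥(C.support : Set s.W)) := by
      have e : (⟨f.base s'.pt, hyC⟩ : ↥(C.support : Set s.W)) = ⟨s.pt, hxC⟩ := Subtype.ext hpt
      rw [e]; exact hC C P' hcs hxC
    have hyc : IsClosed ({f.base s'.pt} : Set s.W) := by rw [hpt]; exact hO.isClosed
    have hdown' : ¬ ∃ B : Set s.W, IsIrreducible B ∧ IsClosed B ∧ f.base s'.pt ∈ B ∧ B ⊆ closure (f.base '' Z') ∧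
        B ≠ {f.base s'.pt} ∧ B ≠ closure (f.base '' Z') := by rw [hpt]; exact hdown
    obtain ⟨z', hfz, hzx, hne, hmax, hclz⟩ := IsBlowup.exists_fibre_component_subset_of_sandwich hbl hO.dim_le hf.isClosed_pt hyc
      ((IdealSheafData.isPermissible_iff C).mp hperm _ hyC) hyC hpos hirr hcl hx' hup hdown'
    refine ⟨z', hfz.trans hpt, hzx, hne, fun w hw hwz => hmax w (hw.trans hpt.symm) hwz, hclz⟩
  · exact absurd (hasSandwichAt_closure_image_of_isBlowup_of_not_mem hbl hpt hf.isClosed_pt hxC hirr hcl hup) hdown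

/-- **… AND AN IRREDUCIBLE FIBRE IS SWALLOWED WHOLE**: under the same hypotheses, if the fibre `f⁻¹(x_n)` is irreducible (the
`ℙ(Dir_{x_n}/T_{x_n}D)` of the W-top dictionary) then `f⁻¹(x_n) ⊆ Z'` — with `Z' ⊆ X_{n+1}(ν)` a stratum component: «the whole fibre over
`x_n` is near», the RULED event read by res-type-067's dictionaries. σ-copy of `preimage_pt_subset_of_hasSandwichAt_of_curve_centre` (p527422).
[cite: CossartJannsenSaito2020, Thm. 3.10 (proof, p. 46)] [cite: Matsumura1987, Thm. 15.1] -/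
theorem StepProjectionσ.preimage_pt_subset_of_hasSandwichAt_of_curve_centre
    (hadm : IsAdmissibleStrategyOn (Strategy.ReachableState p σ 3 ν) 3 ν σ)
    {X : Scheme.{u}} [IsLocallyNoetherian X] {x : X} (hX : IsMaximalOrigin p 3 ν X x) {s s' : MarkedStage.{u}}
    (hreach : Reachesσ σ 3 ν (MarkedStage.init X x) s) {f : s'.W ⟶ s.W} (hf : StepProjectionσ σ 3 ν s s' f)
    (hC : ∀ (C : s.W.IdealSheafData) (P' : Option (Pending (blowup C))), σ.step s.W s.ln 3 ν s.L s.P C P' →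
      ∀ hx : s.pt ∈ (C.support : Set s.W), 1 ≤ coheight (⟨s.pt, hx⟩ : ↥(C.support : Set s.W)))
    (hF : IsIrreducible (f.base ⁻¹' {s.pt}))
    {Z' : Set s'.W} (hirr : IsIrreducible Z') (hcl : IsClosed Z') (hx' : s'.pt ∈ Z') (hup : HasSandwichAt s' Z')
    (hdown : ¬ HasSandwichAt s (closure (f.base '' Z'))) : f.base ⁻¹' {s.pt} ⊆ Z' := by
  haveI := s.ln
  haveI := s'.ln
  have hO : IsMaximalOrigin p 3 ν s.W s.pt := hX.of_reachesσ hadm hreach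
  obtain ⟨z', hfz, -, -, hmax, hclz⟩ := hf.exists_fibre_component_subset_of_hasSandwichAt hadm hX hreach hC hirr hcl hx' hup hdown
  have hFcl : IsClosed (f.base ⁻¹' {s.pt}) := hO.isClosed.preimage f.continuous
  have hgen : IsGenericPoint hF.genericPoint (f.base ⁻¹' {s.pt}) := hF.isGenericPoint_genericPoint hFcl
  have hzF : z' ∈ f.base ⁻¹' {s.pt} := hfz
  have hηF : f.base hF.genericPoint = s.pt := hgen.mem
  have heq : hF.genericPoint = z' := hmax _ hηF (hgen.specializes hzF)
  intro w hw
  have hw' : w ∈ closure ({hF.genericPoint} : Set s'.W) := by rw [hgen.def]; exact hw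
  rw [heq] at hw'
  exact hclz hw'

end Blind

end Summit.ResolutionOfSingularities.ResolutionOfSingularities.Theorems.SigmaMaxModificationsCorridor3.Sigma

end
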